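import Literature.Analysis.FluidPDE.SelfSimilarEulerProfile
import Literature.Analysis.FluidPDE.SelfSimilarEulerProfileVorticity
import Literature.Analysis.FluidPDE.AxisymmetricVorticityTransport
import HarnessLib

/-!
# A swirling fixed point of the meridional self-similar flow forces `γ = ½`
# (Constantin–Ignatova–Vicol 2026, Theorem 4.4)

Analysis/FluidPDE proof file (no definitions, no named facts, no `sorry`).

P. Constantin, M. Ignatova, V. Vicol, *On putative self-similarity for incompressible 3D Euler*
(arXiv:2602.17570), §4, specialise their study of a hypothetical globally self-similar Euler
singularity `u(x,t) = (1−t)^{γ−1} U(x/(1−t)^γ)` to **axisymmetric** profiles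
`U = U_r e_r + U_θ e_θ + U_z e_z`, `P = P(r,z)` (their system (4.1)). The self-similar Lagrangian
flow `dY/dτ = V(Y)`, `V = γ y + U` ((3.19)–(3.20)), then splits into an autonomous **meridional**
system `Ṙ = γR + U_r(R,Z)`, `Ż = γZ + U_z(R,Z)` ((4.4)) and the angle equation
`Θ̇ = U_θ(R,Z)/R` ((4.5)). A **fixed point of the meridional flow** is a point with

  `γ r + U_r(r,z) = 0` and `γ z + U_z(r,z) = 0`   ((4.6));

if moreover `U_θ(r,z) ≠ 0` the circle through it is a periodic orbit of the full flow with
non-zero circulation, and conservation of circulation pins the exponent: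

> **Theorem 4.4.** Assume that `U` is a `C²` smooth, axisymmetric, globally self-similar velocity
> profile for 3D incompressible Euler equations. Assume there exists a fixed point `(r,z)` for the
> dynamics in the meridional plane, i.e. (4.6) holds. If `U_θ(r,z) ≠ 0`, then the similarity
> exponent satisfies `γ = ½`.

In particular (CIV, §4.4 and the kill-test reading of route `NavierStokesRegularity/
EulerZoomLiouville`): inside the Chae–Shvydkoy window `γ ∈ [2/5, ½)` — equivalently velocity
exponent `α = 1 + ρ ∈ (1, 3/2]`, `γ = 1/(α+1) = 1/(2+ρ)`, `ρ > 0` — every fixed point of the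
meridional flow of an axisymmetric profile is **swirl-free**.

## What is proved

All statements are about the tree's `IsSelfSimilarEulerProfile γ c U P` (CIV (3.3) with a free
centre `c`; here the centre must lie ON the axis of symmetry, `c 0 = c 1 = 0`, so that the drift
`γ(y − c)` is rotation-equivariant) with `IsAxisymmetric U` (about the `x₂`-axis, `rotZ`):

* `IsSelfSimilarEulerProfile.isAxisymmetricScalar_pressure` — the pressure profile of an
  axisymmetric velocity profile is automatically an axisymmetric scalar, `P (R_θ y) = P y`
  (CIV write `P = P(r,z)` into the ansatz (4.1); we derive it: `∇(P ∘ R_{−θ}) = ∇P` from the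
  rotation covariance of (3.3), so `P − P ∘ R_{−θ}` is constant and vanishes at the origin).
* `IsSelfSimilarEulerProfile.gamma_eq_half_of_transport_eq_smul_rotGen` — Cartesian core: if at
  some `y` off the axis the transport velocity is purely azimuthal, `V(y) = l • J y` with `l ≠ 0`
  (`J = rotGen`, `J y = r e_θ`), then `γ = ½`.
* `IsSelfSimilarEulerProfile.gamma_eq_half_of_meridional_fixedPoint` — **Theorem 4.4 as
  printed**: `γ r + U_r = 0`, `γ (z − c_z) + U_z = 0` and `U_θ ≠ 0` at a point force `γ = ½`
  (cylindrical components `radialVelocity`, `axialVelocity`, `swirlVelocity` of the tree); and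
  the variant `…_of_swirl_ne_zero` with the polynomial swirl `Γ = r U_θ = swirl U`.
* Contrapositives for consumers: `swirlVelocity_eq_zero_of_meridional_fixedPoint` /
  `swirl_eq_zero_of_meridional_fixedPoint` (`γ ≠ ½` ⇒ meridional fixed points are swirl-free),
  `…_of_lt_half` (the window `γ < ½`) and `…_of_exponent` (`γ = 1/(2+ρ)`, `ρ > 0`).
* `selfSimilarTransport_eq_smul_rotGen_of_meridional_fixedPoint` — at a meridional fixed point off
  the axis `V(y) = (Γ(y)/r²) • J y = U_θ e_θ`;
  `selfSimilarTransport_eq_zero_of_meridional_fixedPoint` — a swirl-free meridional fixed point is a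
  zero of `V` (a point of the nodal set `𝒩_V`).
* **Remark 4.5**, proved: `IsSelfSimilarEulerProfile.swirl_curl_eq_zero_of_transport_eq_zero` /
  `.swirlVelocity_curl_eq_zero_of_meridional_fixedPoint` — at a meridional fixed point with
  `U_θ = 0` also `Ω_θ = 0` (`Ω = curl U`), for `γ ≠ −1`: the vorticity equation (3.4) at the zero
  `y` of `V` reads `Ω = DU·Ω`; pairing with `J y` and using `(Ω·∇)Γ = 0`
  (`IsAxisymmetric.fderiv_swirl_curl`) gives `(1+γ) r Ω_θ = 0`.

## The proof (Cartesian, no Lagrangian flow)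

CIV integrate Kelvin's circulation theorem along the invariant circle. The same number comes out
of the `θ`-component of the profile equation (3.3) at the point: pair
`(1−γ)U + DU[V] + ∇P = 0` with `J y`. With `V(y) = l J y`, infinitesimal axisymmetry
`DU(y)[J y] = J U(y)` (`IsAxisymmetric.fderiv_rotGen`) gives `⟪J y, DU[V]⟫ = l ⟪J y, J U⟫ =
l (y₀U₀ + y₁U₁)`, the pressure term is `∂_θ P = 0` (`IsAxisymmetricScalar.inner_rotGen_gradient`),
and `U = lJy − γ(y − c)` turns the identity into `l r² (1 − 2γ) = 0`. This is the printed
`Γ`-equation `(γr+U_r)∂_r(rU_θ) + (γz+U_z)∂_z(rU_θ) + (1−2γ) rU_θ = 0` (CIV, proof of Thm 4.6)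
evaluated at the fixed point.

Scope (what is NOT claimed): nothing about the exponent at swirl-free fixed points (CIV Thm 4.3,
Thm 4.6 — the latter needs Poincaré–Bendixson), nothing about non-axisymmetric profiles, and no
existence statement of any kind. `C²`/`C¹` regularity is that of `IsSelfSimilarEulerProfile`;
the argument itself only uses differentiability at the point.

## Mathlib / tree search

Tree: `IsSelfSimilarEulerProfile`, `selfSimilarTransport` (`SelfSimilarEulerProfile`);
`IsAxisymmetric`, `IsAxisymmetricScalar`, `rotZ`, `cylRadius`, `eR`, `eTheta`, `radialVelocity`,
`swirlVelocity`, `axialVelocity`, `swirl`, `swirl_eq_cylRadius_mul_swirlVelocity`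
(`AxisymmetricEuler`); `rotGen`, `inner_rotGen_left`, `IsAxisymmetric.fderiv_rotGen`,
`IsAxisymmetricScalar.inner_rotGen_gradient` (`SwirlTransportProofs`); `rotZL`, `rotZLIE`,
`IsAxisymmetric.fderiv_rotZ`, and the model `IsClassicalNSSolutionOn.isAxisymmetricScalar_pressure`
(`AxisymmetricVorticityTransport`). `lean search 'Theorem 4.4|meridional|swirling'`: CIV §4 was
not in the tree (`SelfSimilarSwirlExclusion` is Hou's `γ < ½` remark for the time-dependent
ansatz with bounded swirl, a different statement). Mathlib: `is_const_of_fderiv_eq_zero`,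
`LinearIsometryEquiv.inner_map_map`.

## References

* P. Constantin, M. Ignatova, V. Vicol, *On putative self-similarity for incompressible 3D
  Euler*, arXiv:2602.17570 (2026), §4 eqs. (4.1), (4.4)–(4.6), Thm. 4.4, proof of Thm. 4.6 (the
  `rU_θ` transport identity). [ConstantinIgnatovaVicol2026Putative]
-/

noncomputable section

open Set InnerProductSpace
open scoped RealInnerProductSpace

namespace Literature.Analysis.FluidPDE

/-! ### Cylindrical components in coordinates (private plumbing) -/

/-- `r · u_r(x) = x₀ u₀(x) + x₁ u₁(x)` (both sides vanish on the axis, where `eR` has its junk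
value `0`). [folklore] -/
private theorem cylRadius_mul_radialVelocity
    (u : EuclideanSpace ℝ (Fin 3) → EuclideanSpace ℝ (Fin 3)) (x : EuclideanSpace ℝ (Fin 3)) :
    cylRadius x * radialVelocity u x = x 0 * u x 0 + x 1 * u x 1 := by
  by_cases hx : cylRadius x = 0
  · obtain ⟨h0, h1⟩ := (cylRadius_eq_zero_iff x).1 hx
    simp [hx, h0, h1]
  · simp only [radialVelocity, eR, PiLp.inner_apply, Fin.sum_univ_three, PiLp.smul_apply,
      RCLike.inner_apply, conj_trivial, smul_eq_mul, Matrix.cons_val_zero, Matrix.cons_val_one,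
      Matrix.cons_val_two, Matrix.head_cons, Matrix.tail_cons]
    field_simp
    ring

/-- The swirl velocity has junk value `0` on the axis, so `u_θ(x) ≠ 0` forces `r(x) ≠ 0`.
[folklore] -/
private theorem cylRadius_ne_zero_of_swirlVelocity_ne_zero
    {u : EuclideanSpace ℝ (Fin 3) → EuclideanSpace ℝ (Fin 3)} {x : EuclideanSpace ℝ (Fin 3)}
    (h : swirlVelocity u x ≠ 0) : cylRadius x ≠ 0 := by
  intro hx
  apply h
  simp [swirlVelocity, eTheta, hx]

/-- Rotations about the axis fix the points of the axis. [folklore] -/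
private theorem rotZ_of_onAxis (θ : ℝ) {c : EuclideanSpace ℝ (Fin 3)} (hc : c 0 = 0 ∧ c 1 = 0) :
    rotZ θ c = c := by
  ext i
  fin_cases i <;> simp [hc.1, hc.2]

/-- Rotations about the axis preserve the inner product. [folklore] -/
private theorem inner_rotZ_rotZ_eq (θ : ℝ) (v w : EuclideanSpace ℝ (Fin 3)) :
    ⟪rotZ θ v, rotZ θ w⟫ = ⟪v, w⟫ := by
  rw [← rotZLIE_apply, ← rotZLIE_apply, LinearIsometryEquiv.inner_map_map]

namespace IsSelfSimilarEulerProfile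

variable {γ : ℝ} {c : EuclideanSpace ℝ (Fin 3)}
  {U : EuclideanSpace ℝ (Fin 3) → EuclideanSpace ℝ (Fin 3)} {P : EuclideanSpace ℝ (Fin 3) → ℝ}

/-! ### The pressure of an axisymmetric profile is axisymmetric -/

/-- **Rotation covariance of the pressure gradient.** For an axisymmetric velocity profile with
centre on the axis, `R_θ (∇P (z)) = ∇P (R_θ z)`: the profile equation (3.3) expresses `∇P` through
`U`, `DU` and the drift `γ(y − c)`, all of which are `R_θ`-equivariant. [cite: ConstantinIgnatovaVicol2026Putative, §4 eq. (4.1)] -/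
theorem rotZ_gradient_pressure (h : IsSelfSimilarEulerProfile γ c U P) (hU : IsAxisymmetric U)
    (hc : c 0 = 0 ∧ c 1 = 0) (θ : ℝ) (z : EuclideanSpace ℝ (Fin 3)) :
    rotZ θ (gradient P z) = gradient P (rotZ θ z) := by
  have hd := h.differentiable_velocity
  have ez := h.profile_eq z
  have ey := h.profile_eq (rotZ θ z)
  -- `∇P = −((1−γ)U + DU[V])` at both points
  have gz : gradient P z = -((1 - γ) • U z + fderiv ℝ U z (γ • (z - c) + U z)) :=
    eq_neg_of_add_eq_zero_right ez
  have gy : gradient P (rotZ θ z) =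
      -((1 - γ) • U (rotZ θ z) + fderiv ℝ U (rotZ θ z) (γ • (rotZ θ z - c) + U (rotZ θ z))) :=
    eq_neg_of_add_eq_zero_right ey
  -- equivariance of the drift and of the Jacobian
  have hV : γ • (rotZ θ z - c) + U (rotZ θ z) = rotZL θ (γ • (z - c) + U z) := by
    rw [map_add, map_smul, map_sub, rotZL_apply, rotZL_apply, rotZL_apply, rotZ_of_onAxis θ hc,
      hU θ z]
  have hD : fderiv ℝ U (rotZ θ z) (rotZL θ (γ • (z - c) + U z)) =
      rotZ θ (fderiv ℝ U z (γ • (z - c) + U z)) := by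
    rw [hU.fderiv_rotZ hd θ z]
    simp only [ContinuousLinearMap.comp_apply, rotZL_apply]
    rw [← rotZ_add, neg_add_cancel, rotZ_zero]
  rw [gy, hV, hD, hU θ z, gz]
  rw [← rotZL_apply θ, map_neg, map_add, map_smul, rotZL_apply, rotZL_apply]

/-- **The pressure profile of an axisymmetric self-similar profile is an axisymmetric scalar**,
`P (R_θ y) = P (y)` (CIV §4: "The pressure is `P = P(r,z)`"), provided the centre lies on the axis
of symmetry. Proof: `P ∘ R_{−θ}` has the same derivative as `P` everywhere
(`rotZ_gradient_pressure` and `R_θ`-invariance of the inner product), so their difference is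
constant, and it vanishes at the origin, a fixed point of `R_{−θ}`. [cite: ConstantinIgnatovaVicol2026Putative, §4 eq. (4.1)] -/
theorem isAxisymmetricScalar_pressure (h : IsSelfSimilarEulerProfile γ c U P)
    (hU : IsAxisymmetric U) (hc : c 0 = 0 ∧ c 1 = 0) : IsAxisymmetricScalar P := by
  have hPd := h.differentiable_pressure
  have key : ∀ θ : ℝ, ∀ x : EuclideanSpace ℝ (Fin 3), P (rotZ (-θ) x) = P x := by
    intro θ
    have hQd : Differentiable ℝ (fun y => P (rotZL (-θ) y)) :=
      hPd.comp (rotZL (-θ)).differentiable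
    -- the two functions have the same derivative
    have hfd : ∀ x, fderiv ℝ (fun y => P (rotZL (-θ) y)) x = fderiv ℝ P x := by
      intro x
      have hcomp : HasFDerivAt (fun y => P (rotZL (-θ) y))
          ((fderiv ℝ P (rotZL (-θ) x)).comp (rotZL (-θ))) x :=
        (hPd _).hasFDerivAt.comp x (rotZL (-θ)).hasFDerivAt
      rw [hcomp.fderiv]
      ext v
      rw [ContinuousLinearMap.comp_apply, rotZL_apply, rotZL_apply]
      have e1 : fderiv ℝ P (rotZ (-θ) x) (rotZ (-θ) v) =
          ⟪gradient P (rotZ (-θ) x), rotZ (-θ) v⟫ := by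
        rw [gradient, InnerProductSpace.toDual_symm_apply]
      have e2 : fderiv ℝ P x v = ⟪gradient P x, v⟫ := by
        rw [gradient, InnerProductSpace.toDual_symm_apply]
      rw [e1, e2, ← inner_rotZ_rotZ_eq θ, h.rotZ_gradient_pressure hU hc θ, ← rotZ_add,
        ← rotZ_add, add_neg_cancel, rotZ_zero, rotZ_zero]
    -- hence the difference is constant, and zero at the origin
    have hqd : Differentiable ℝ (fun y => P y - P (rotZL (-θ) y)) := hPd.sub hQd
    have hq : ∀ x, fderiv ℝ (fun y => P y - P (rotZL (-θ) y)) x = 0 := fun x => by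
      rw [fderiv_fun_sub (hPd x) (hQd x), hfd x, sub_self]
    intro x
    have hconst := is_const_of_fderiv_eq_zero hqd hq x 0
    simp only [map_zero, sub_self, rotZL_apply] at hconst
    exact (sub_eq_zero.1 hconst).symm
  intro θ x
  simpa using key (-θ) x

/-! ### Theorem 4.4 -/

/-- **Cartesian core of CIV Theorem 4.4.** Let `(U,P)` be a self-similar Euler profile with
exponent `γ`, centre `c` on the axis, `U` axisymmetric and `P` an axisymmetric scalar. If at a
point `y` off the axis the transport velocity `V(y) = γ(y − c) + U(y)` is purely azimuthal,
`V(y) = l • J y` (`J = rotGen`, `J y = r e_θ`) with `l ≠ 0`, then `γ = ½`. Pairing the profile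
equation at `y` with `J y` gives `(1−γ)⟪Jy, U⟫ + l⟪Jy, JU⟫ + ∂_θP = 0`, i.e.
`l r² (1 − 2γ) = 0`. [cite: ConstantinIgnatovaVicol2026Putative, §4.3 Thm. 4.4] -/
theorem gamma_eq_half_of_transport_eq_smul_rotGen (h : IsSelfSimilarEulerProfile γ c U P)
    (hU : IsAxisymmetric U) (hP : IsAxisymmetricScalar P) (hc : c 0 = 0 ∧ c 1 = 0)
    {y : EuclideanSpace ℝ (Fin 3)} {l : ℝ} (hV : γ • (y - c) + U y = l • rotGen y) (hl : l ≠ 0)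
    (hy : cylRadius y ≠ 0) :
    γ = 1 / 2 := by
  have hd : DifferentiableAt ℝ U y := h.differentiable_velocity y
  have hPd : DifferentiableAt ℝ P y := h.differentiable_pressure y
  have e := h.profile_eq y
  rw [hV, map_smul, hU.fderiv_rotGen hd] at e
  -- pair with `J y`
  have e2 : (1 - γ) * ⟪rotGen y, U y⟫ + l * ⟪rotGen y, rotGen (U y)⟫ = 0 := by
    have := congrArg (fun w : EuclideanSpace ℝ (Fin 3) => ⟪rotGen y, w⟫) e
    simpa only [inner_add_right, real_inner_smul_right, inner_zero_right,
      hP.inner_rotGen_gradient hPd, add_zero] using this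
  rw [inner_rotGen_left, inner_rotGen_left, rotGen_apply_zero, rotGen_apply_one] at e2
  -- components of `V(y) = l J y`
  have h0 : γ * y 0 + U y 0 = -(l * y 1) := by
    have := congrArg (fun w : EuclideanSpace ℝ (Fin 3) => w 0) hV
    simpa [hc.1] using this
  have h1 : γ * y 1 + U y 1 = l * y 0 := by
    have := congrArg (fun w : EuclideanSpace ℝ (Fin 3) => w 1) hV
    simpa [hc.2] using this
  have hA : U y 0 = -(l * y 1) - γ * y 0 := by linarith
  have hB : U y 1 = l * y 0 - γ * y 1 := by linarith
  rw [hA, hB] at e2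
  have key : l * (y 0 ^ 2 + y 1 ^ 2) * (1 - 2 * γ) = 0 := by linear_combination e2
  have hr : y 0 ^ 2 + y 1 ^ 2 ≠ 0 := by
    rw [← cylRadius_sq]; exact pow_ne_zero 2 hy
  rcases mul_eq_zero.1 key with h' | h'
  · rcases mul_eq_zero.1 h' with h'' | h''
    · exact absurd h'' hl
    · exact absurd h'' hr
  · linarith

/-- **CIV Theorem 4.4, with the polynomial swirl `Γ = r U_θ`.** Let `(U,P)` be a `C²` self-similar
Euler profile with exponent `γ` and centre `c` on the axis of symmetry, `U` axisymmetric. If `y`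
is a fixed point of the meridional self-similar flow — `γ r + U_r (y) = 0` and
`γ (y₂ − c₂) + U_z (y) = 0` ((4.6), axial coordinate measured from the centre) — and the swirl
`Γ(y) = y₀U₁ − y₁U₀ = r U_θ` does not vanish there, then `γ = ½`. [cite: ConstantinIgnatovaVicol2026Putative, §4.3 Thm. 4.4] -/
theorem gamma_eq_half_of_meridional_fixedPoint_of_swirl_ne_zero
    (h : IsSelfSimilarEulerProfile γ c U P) (hU : IsAxisymmetric U) (hc : c 0 = 0 ∧ c 1 = 0)
    {y : EuclideanSpace ℝ (Fin 3)} (hr : γ * cylRadius y + radialVelocity U y = 0)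
    (hz : γ * (y 2 - c 2) + axialVelocity U y = 0) (hθ : swirl U y ≠ 0) : γ = 1 / 2 := by
  have hP := h.isAxisymmetricScalar_pressure hU hc
  -- off the axis
  have hy : cylRadius y ≠ 0 := fun h0 => hθ (swirl_eq_zero_of_cylRadius_eq_zero U h0)
  have hr2 : y 0 ^ 2 + y 1 ^ 2 ≠ 0 := by
    rw [← cylRadius_sq]; exact pow_ne_zero 2 hy
  -- the radial condition in coordinates: `γ r² + (y₀U₀ + y₁U₁) = 0`
  have hrad : γ * (y 0 ^ 2 + y 1 ^ 2) + (y 0 * U y 0 + y 1 * U y 1) = 0 := by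
    have := congrArg (fun s => cylRadius y * s) hr
    simp only [mul_add, mul_zero, cylRadius_mul_radialVelocity] at this
    rw [← cylRadius_sq]
    linear_combination this
  have hax : γ * (y 2 - c 2) + U y 2 = 0 := hz
  -- `V(y) = l J y` with `l = Γ / r²`
  set l : ℝ := swirl U y / (y 0 ^ 2 + y 1 ^ 2) with hl_def
  have hsw : swirl U y = y 0 * U y 1 - y 1 * U y 0 := rfl
  have hl : l ≠ 0 := div_ne_zero hθ hr2
  have hV : γ • (y - c) + U y = l • rotGen y := by
    have hly : l * (y 0 ^ 2 + y 1 ^ 2) = y 0 * U y 1 - y 1 * U y 0 := by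
      rw [hl_def, div_mul_cancel₀ _ hr2, hsw]
    ext i
    fin_cases i
    · simp only [PiLp.add_apply, PiLp.smul_apply, PiLp.sub_apply, smul_eq_mul, Fin.zero_eta,
        rotGen_apply_zero, hc.1, sub_zero]
      have : (γ * y 0 + U y 0) * (y 0 ^ 2 + y 1 ^ 2) = (l * -y 1) * (y 0 ^ 2 + y 1 ^ 2) := by
        linear_combination y 0 * hrad + y 1 * hly
      exact mul_right_cancel₀ hr2 this
    · simp only [PiLp.add_apply, PiLp.smul_apply, PiLp.sub_apply, smul_eq_mul, Fin.mk_one,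
        rotGen_apply_one, hc.2, sub_zero]
      have : (γ * y 1 + U y 1) * (y 0 ^ 2 + y 1 ^ 2) = (l * y 0) * (y 0 ^ 2 + y 1 ^ 2) := by
        linear_combination y 1 * hrad + (-y 0) * hly
      exact mul_right_cancel₀ hr2 this
    · simp only [PiLp.add_apply, PiLp.smul_apply, PiLp.sub_apply, smul_eq_mul, Fin.reduceFinMk,
        rotGen_apply_two, mul_zero]
      exact hax
  exact h.gamma_eq_half_of_transport_eq_smul_rotGen hU hP hc hV hl hy

/-- **CIV Theorem 4.4 as printed.** Let `(U,P)` be a `C²` self-similar Euler profile with exponent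
`γ` and centre `c` on the axis of symmetry, `U` axisymmetric. If `y` is a fixed point of the
meridional self-similar flow, `γ r + U_r (y) = 0` and `γ (y₂ − c₂) + U_z (y) = 0` ((4.6)), and the
swirl velocity does not vanish there, `U_θ (y) ≠ 0`, then `γ = ½`. [cite: ConstantinIgnatovaVicol2026Putative, §4.3 Thm. 4.4] -/
theorem gamma_eq_half_of_meridional_fixedPoint (h : IsSelfSimilarEulerProfile γ c U P)
    (hU : IsAxisymmetric U) (hc : c 0 = 0 ∧ c 1 = 0) {y : EuclideanSpace ℝ (Fin 3)}
    (hr : γ * cylRadius y + radialVelocity U y = 0) (hz : γ * (y 2 - c 2) + axialVelocity U y = 0)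
    (hθ : swirlVelocity U y ≠ 0) : γ = 1 / 2 := by
  have hy : cylRadius y ≠ 0 := cylRadius_ne_zero_of_swirlVelocity_ne_zero hθ
  have hsw : swirl U y ≠ 0 := by
    rw [swirl_eq_cylRadius_mul_swirlVelocity U hy]
    exact mul_ne_zero hy hθ
  exact h.gamma_eq_half_of_meridional_fixedPoint_of_swirl_ne_zero hU hc hr hz hsw

/-! ### Consequences: off the parabolic exponent, meridional fixed points are swirl-free -/

/-- For `γ ≠ ½`, the swirl velocity vanishes at every fixed point of the meridional self-similar
flow of an axisymmetric `C²` profile (contrapositive of Theorem 4.4; CIV §4.4: "if the swirl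
velocity does not vanish at a solution of (4.6), Theorem 4.4 already gives `γ = ½`"). [cite: ConstantinIgnatovaVicol2026Putative, §4.3 Thm. 4.4] -/
theorem swirlVelocity_eq_zero_of_meridional_fixedPoint (h : IsSelfSimilarEulerProfile γ c U P)
    (hU : IsAxisymmetric U) (hc : c 0 = 0 ∧ c 1 = 0) (hγ : γ ≠ 1 / 2)
    {y : EuclideanSpace ℝ (Fin 3)} (hr : γ * cylRadius y + radialVelocity U y = 0)
    (hz : γ * (y 2 - c 2) + axialVelocity U y = 0) : swirlVelocity U y = 0 := by
  by_contra hθ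
  exact hγ (h.gamma_eq_half_of_meridional_fixedPoint hU hc hr hz hθ)

/-- The same for the polynomial swirl `Γ = r U_θ`: `Γ(y) = 0` at every meridional fixed point when
`γ ≠ ½`. [cite: ConstantinIgnatovaVicol2026Putative, §4.3 Thm. 4.4] -/
theorem swirl_eq_zero_of_meridional_fixedPoint (h : IsSelfSimilarEulerProfile γ c U P)
    (hU : IsAxisymmetric U) (hc : c 0 = 0 ∧ c 1 = 0) (hγ : γ ≠ 1 / 2)
    {y : EuclideanSpace ℝ (Fin 3)} (hr : γ * cylRadius y + radialVelocity U y = 0)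
    (hz : γ * (y 2 - c 2) + axialVelocity U y = 0) : swirl U y = 0 := by
  by_contra hθ
  exact hγ (h.gamma_eq_half_of_meridional_fixedPoint_of_swirl_ne_zero hU hc hr hz hθ)

/-- **In the window `γ < ½`** (Constantin–Ignatova–Vicol's regime of interest for a viscous
lift, §4.4; the Chae–Shvydkoy window `γ ∈ [2/5, ½)`), meridional fixed points of an axisymmetric
`C²` profile are swirl-free. [cite: ConstantinIgnatovaVicol2026Putative, §4.3 Thm. 4.4] -/
theorem swirlVelocity_eq_zero_of_meridional_fixedPoint_of_lt_half
    (h : IsSelfSimilarEulerProfile γ c U P) (hU : IsAxisymmetric U) (hc : c 0 = 0 ∧ c 1 = 0)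
    (hγ : γ < 1 / 2) {y : EuclideanSpace ℝ (Fin 3)}
    (hr : γ * cylRadius y + radialVelocity U y = 0)
    (hz : γ * (y 2 - c 2) + axialVelocity U y = 0) : swirlVelocity U y = 0 :=
  h.swirlVelocity_eq_zero_of_meridional_fixedPoint hU hc hγ.ne hr hz

/-- **In the velocity-exponent parametrisation** `γ = 1/(2+ρ)` (`α = 1+ρ`, the exactly self-similar
members `u = (−τ)^{−(1+ρ)/(2+ρ)} V((−τ)^{−1/(2+ρ)} y)` of a power-gauged Euler class), every
`ρ > 0` gives `γ < ½`, so meridional fixed points of an axisymmetric `C²` profile are swirl-free.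
[cite: ConstantinIgnatovaVicol2026Putative, §4.3 Thm. 4.4] -/
theorem swirlVelocity_eq_zero_of_meridional_fixedPoint_of_exponent {ρ : ℝ} (hρ : 0 < ρ)
    (hγ : γ = 1 / (2 + ρ)) (h : IsSelfSimilarEulerProfile γ c U P) (hU : IsAxisymmetric U)
    (hc : c 0 = 0 ∧ c 1 = 0) {y : EuclideanSpace ℝ (Fin 3)}
    (hr : γ * cylRadius y + radialVelocity U y = 0)
    (hz : γ * (y 2 - c 2) + axialVelocity U y = 0) : swirlVelocity U y = 0 := by
  have hlt : γ < 1 / 2 := by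
    rw [hγ]
    exact one_div_lt_one_div_of_lt (by norm_num) (by linarith)
  exact h.swirlVelocity_eq_zero_of_meridional_fixedPoint_of_lt_half hU hc hlt hr hz

end IsSelfSimilarEulerProfile

/-! ### The transport velocity at a meridional fixed point; Remark 4.5 -/

/-- On the axis of symmetry the horizontal components of an axisymmetric field vanish
(`U(R_π y) = R_π U(y)` with `R_π y = y`). [folklore] -/
private theorem horizontal_eq_zero_of_onAxis
    {u : EuclideanSpace ℝ (Fin 3) → EuclideanSpace ℝ (Fin 3)} (hu : IsAxisymmetric u)
    {y : EuclideanSpace ℝ (Fin 3)} (h0 : y 0 = 0) (h1 : y 1 = 0) : u y 0 = 0 ∧ u y 1 = 0 := by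
  have hy : rotZ Real.pi y = y := by
    ext i
    fin_cases i <;> simp [h0, h1]
  have h := hu Real.pi y
  rw [hy] at h
  have e0 := congrArg (fun w : EuclideanSpace ℝ (Fin 3) => w 0) h
  have e1 := congrArg (fun w : EuclideanSpace ℝ (Fin 3) => w 1) h
  simp only [rotZ_apply_zero, rotZ_apply_one, Real.cos_pi, Real.sin_pi] at e0 e1
  constructor <;> linarith

/-- **At a meridional fixed point off the axis the transport velocity is purely azimuthal**:
if `γ r + U_r(y) = 0` and `γ(y₂ − c₂) + U_z(y) = 0` ((4.6), centre `c` on the axis) and `r ≠ 0`,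
then `V(y) = γ(y − c) + U(y) = (Γ(y)/r²) • J y` with `Γ = r U_θ = swirl U`, i.e. `V = U_θ e_θ`
(CIV §4.2: "`V = V_r e_r + U_θ e_θ + V_z e_z`"). Pure coordinate algebra, no profile equation.
[cite: ConstantinIgnatovaVicol2026Putative, §4.3 eq. (4.6)] -/
theorem selfSimilarTransport_eq_smul_rotGen_of_meridional_fixedPoint {γ : ℝ}
    {c : EuclideanSpace ℝ (Fin 3)} {U : EuclideanSpace ℝ (Fin 3) → EuclideanSpace ℝ (Fin 3)}
    (hc : c 0 = 0 ∧ c 1 = 0) {y : EuclideanSpace ℝ (Fin 3)}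
    (hr : γ * cylRadius y + radialVelocity U y = 0)
    (hz : γ * (y 2 - c 2) + axialVelocity U y = 0) (hy : cylRadius y ≠ 0) :
    selfSimilarTransport γ c U y = (swirl U y / cylRadius y ^ 2) • rotGen y := by
  have hr2 : y 0 ^ 2 + y 1 ^ 2 ≠ 0 := by
    rw [← cylRadius_sq]; exact pow_ne_zero 2 hy
  have hrad : γ * (y 0 ^ 2 + y 1 ^ 2) + (y 0 * U y 0 + y 1 * U y 1) = 0 := by
    have := congrArg (fun s => cylRadius y * s) hr
    simp only [mul_add, mul_zero, cylRadius_mul_radialVelocity] at this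
    rw [← cylRadius_sq]
    linear_combination this
  have hax : γ * (y 2 - c 2) + U y 2 = 0 := hz
  have hsw : swirl U y = y 0 * U y 1 - y 1 * U y 0 := rfl
  have hly : swirl U y / cylRadius y ^ 2 * (y 0 ^ 2 + y 1 ^ 2) = y 0 * U y 1 - y 1 * U y 0 := by
    rw [cylRadius_sq, div_mul_cancel₀ _ hr2, hsw]
  rw [selfSimilarTransport_apply]
  ext i
  fin_cases i
  · simp only [PiLp.add_apply, PiLp.smul_apply, PiLp.sub_apply, smul_eq_mul, Fin.zero_eta,
      rotGen_apply_zero, hc.1, sub_zero]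
    have : (γ * y 0 + U y 0) * (y 0 ^ 2 + y 1 ^ 2) =
        (swirl U y / cylRadius y ^ 2 * -y 1) * (y 0 ^ 2 + y 1 ^ 2) := by
      linear_combination y 0 * hrad + y 1 * hly
    exact mul_right_cancel₀ hr2 this
  · simp only [PiLp.add_apply, PiLp.smul_apply, PiLp.sub_apply, smul_eq_mul, Fin.mk_one,
      rotGen_apply_one, hc.2, sub_zero]
    have : (γ * y 1 + U y 1) * (y 0 ^ 2 + y 1 ^ 2) =
        (swirl U y / cylRadius y ^ 2 * y 0) * (y 0 ^ 2 + y 1 ^ 2) := by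
      linear_combination y 1 * hrad + (-y 0) * hly
    exact mul_right_cancel₀ hr2 this
  · simp only [PiLp.add_apply, PiLp.smul_apply, PiLp.sub_apply, smul_eq_mul, Fin.reduceFinMk,
      rotGen_apply_two, mul_zero]
    exact hax

/-- **A swirl-free meridional fixed point is a stagnation point of the self-similar flow**: if
`γ r + U_r(y) = 0`, `γ(y₂ − c₂) + U_z(y) = 0` and `Γ(y) = 0` (for an axisymmetric `U` with centre
on the axis), then `V(y) = 0`, i.e. `y ∈ 𝒩_V` (CIV §4.2: "`(r_*,z_*)` is a zero of `V` iff
`γ r_* + U_r = U_θ = γ z_* + U_z = 0`"). On the axis this uses that the horizontal components of an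
axisymmetric field vanish there (Remark 4.2). [cite: ConstantinIgnatovaVicol2026Putative, §4.2] -/
theorem selfSimilarTransport_eq_zero_of_meridional_fixedPoint {γ : ℝ}
    {c : EuclideanSpace ℝ (Fin 3)} {U : EuclideanSpace ℝ (Fin 3) → EuclideanSpace ℝ (Fin 3)}
    (hU : IsAxisymmetric U) (hc : c 0 = 0 ∧ c 1 = 0) {y : EuclideanSpace ℝ (Fin 3)}
    (hr : γ * cylRadius y + radialVelocity U y = 0)
    (hz : γ * (y 2 - c 2) + axialVelocity U y = 0) (hθ : swirl U y = 0) :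
    selfSimilarTransport γ c U y = 0 := by
  by_cases hy : cylRadius y = 0
  · obtain ⟨h0, h1⟩ := (cylRadius_eq_zero_iff y).1 hy
    obtain ⟨u0, u1⟩ := horizontal_eq_zero_of_onAxis hU h0 h1
    have hax : γ * (y 2 - c 2) + U y 2 = 0 := hz
    rw [selfSimilarTransport_apply]
    ext i
    fin_cases i
    · simp [h0, hc.1, u0]
    · simp [h1, hc.2, u1]
    · simpa using hax
  · rw [selfSimilarTransport_eq_smul_rotGen_of_meridional_fixedPoint hc hr hz hy, hθ, zero_div,
      zero_smul]

namespace IsSelfSimilarEulerProfile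

variable {γ : ℝ} {c : EuclideanSpace ℝ (Fin 3)}
  {U : EuclideanSpace ℝ (Fin 3) → EuclideanSpace ℝ (Fin 3)} {P : EuclideanSpace ℝ (Fin 3) → ℝ}

/-- **CIV Remark 4.5, Cartesian form.** At a zero `y` of the transport field `V = γ(y − c) + U`
of an axisymmetric `C²` profile (centre on the axis), the swirl of the vorticity vanishes:
`⟪J y, Ω(y)⟫ = r Ω_θ(y) = 0`, `Ω = curl U`, provided `γ ≠ −1`. Proof: the vorticity equation (3.4)
`Ω + DΩ[V] = DU·Ω` at `y` reads `Ω = DU·Ω`; pairing with `J y` and using `(Ω·∇)Γ = 0`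
(`IsAxisymmetric.fderiv_swirl_curl`: `⟪Jy, DU·Ω⟫ = ⟪Ω, J U⟫`) and `U(y) = −γ(y − c)` gives
`⟪Jy, Ω⟫ = −γ ⟪Jy, Ω⟫`. [cite: ConstantinIgnatovaVicol2026Putative, §4.3 Rem. 4.5] -/
theorem swirl_curl_eq_zero_of_transport_eq_zero (h : IsSelfSimilarEulerProfile γ c U P)
    (hU : IsAxisymmetric U) (hc : c 0 = 0 ∧ c 1 = 0) (hγ : γ ≠ -1) {y : EuclideanSpace ℝ (Fin 3)}
    (hV : selfSimilarTransport γ c U y = 0) : swirl (curl U) y = 0 := by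
  have hd : DifferentiableAt ℝ U y := h.differentiable_velocity y
  -- the vorticity equation at the stagnation point: `Ω = DU·Ω`
  have hvort := h.isSelfSimilarEulerVorticityProfile.vorticity_eq_transport y
  rw [hV, map_zero, add_zero] at hvort
  -- `(Ω·∇)Γ = 0`: `⟪Jy, DU·Ω⟫ = -⟪JΩ, U⟫`
  have hΓ := hU.fderiv_swirl_curl hd
  rw [fderiv_swirl_apply hd] at hΓ
  -- `U(y) = -γ (y - c)` and `J c = 0`
  have hUy : U y = -(γ • (y - c)) := by
    rw [selfSimilarTransport_apply] at hV
    exact eq_neg_of_add_eq_zero_right hV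
  have hJc : rotGen c = 0 := by
    ext i
    fin_cases i <;> simp [hc.1, hc.2]
  have hJU : rotGen (U y) = -(γ • rotGen y) := by
    rw [hUy, ← rotGenL_apply, map_neg, map_smul, map_sub, rotGenL_apply, rotGenL_apply, hJc,
      sub_zero]
  -- assemble: `⟪Jy, Ω⟫ = ⟪Jy, DU Ω⟫ = -⟪JΩ, U⟫ = ⟪Ω, JU⟫ = -γ⟪Ω, Jy⟫`
  have e1 : ⟪rotGen y, curl U y⟫ = -⟪rotGen (curl U y), U y⟫ := by
    conv_lhs => rw [hvort]
    linarith
  rw [inner_rotGen_left_eq_neg (curl U y) (U y), hJU, inner_neg_right, real_inner_smul_right,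
    neg_neg, real_inner_comm (rotGen y) (curl U y)] at e1
  -- `e1 : ⟪Jy, Ω⟫ = -(γ * ⟪Jy, Ω⟫)`
  have hkey : (1 + γ) * ⟪rotGen y, curl U y⟫ = 0 := by linarith
  have h1 : (1 + γ) ≠ 0 := fun h0 => hγ (by linarith)
  have hzero : ⟪rotGen y, curl U y⟫ = 0 := by
    rcases mul_eq_zero.1 hkey with h' | h'
    · exact absurd h' h1
    · exact h'
  rw [swirl_eq_inner_rotGen]
  exact hzero

/-- **CIV Remark 4.5 as printed.** If `(r,z)` solves (4.6) — a fixed point of the meridional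
self-similar flow of an axisymmetric `C²` profile with centre on the axis — and `U_θ(r,z) = 0`,
then also `Ω_θ(r,z) = 0` (`Ω = curl U`; here for every `γ ≠ −1`, CIV have `γ > 0`).
[cite: ConstantinIgnatovaVicol2026Putative, §4.3 Rem. 4.5] -/
theorem swirlVelocity_curl_eq_zero_of_meridional_fixedPoint (h : IsSelfSimilarEulerProfile γ c U P)
    (hU : IsAxisymmetric U) (hc : c 0 = 0 ∧ c 1 = 0) (hγ : γ ≠ -1) {y : EuclideanSpace ℝ (Fin 3)}
    (hr : γ * cylRadius y + radialVelocity U y = 0)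
    (hz : γ * (y 2 - c 2) + axialVelocity U y = 0) (hθ : swirlVelocity U y = 0) :
    swirlVelocity (curl U) y = 0 := by
  by_cases hy : cylRadius y = 0
  · simp [swirlVelocity, eTheta, hy]
  · have hsw : swirl U y = 0 := by
      rw [swirl_eq_cylRadius_mul_swirlVelocity U hy, hθ, mul_zero]
    have hV := selfSimilarTransport_eq_zero_of_meridional_fixedPoint hU hc hr hz hsw
    have hΩ := h.swirl_curl_eq_zero_of_transport_eq_zero hU hc hγ hV
    rw [swirl_eq_cylRadius_mul_swirlVelocity (curl U) hy] at hΩ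
    rcases mul_eq_zero.1 hΩ with h' | h'
    · exact absurd h' hy
    · exact h'

end IsSelfSimilarEulerProfile

end Literature.Analysis.FluidPDE

end
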